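import Summits.PneNP.PneNP.Theorems.ConvexRankGatesConvexGateBlindExactLiftingTrianglePlaneLocal

/-!
# Triangle instance — plane-local factorisations: the EXACT ε-free limit of the dictionary problem

Support file for crux `ConvexGateBlind` (stmt-PneNP-10680), open stub `stub_exactLifting` (prover seat 3, session 15);
sequel of `…TrianglePlaneLocal` (plane-local factorisations of `M_t − εJ` ⇔ the `t × t` dictionary problem `(D_ε)`).
Whether plane-local factorisations beat `t³` ε-UNIFORMLY is the question "does a dictionary of `o(t²)` matrices solve
`(D_ε)` for SOME `ε > 0`"; this file removes `ε` from it exactly.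
* `AddSolves H` — the ADDITIVE COUPLING condition: at every pair `(P,S)` with all four classes non-empty there are
  non-negative combinations `X₀, X₁` of the dictionary with ADDITIVE difference `X₀ − X₁ = α ⊕ β`, `α > 0` on `P`,
  `< 0` off `P`, `β > 0` on `S`, `< 0` off `S`, and `X₀(a,d') < α a` (`a ∈ P, d' ∉ S`), `X₀(a',d) < β d`
  (`a' ∉ P, d ∈ S`).  Scale-free, no `ε`.
* `addSolves_of_dictSolvesL` (necessity, `α a = 2[a ∈ P] − 1 − f₀ a + f₁ a`) and `dictSolvesL_of_addSolves`
  (sufficiency: scale by a small `κ`, lines `1 ∓ κα`, `1 ∓ κβ`; the background is forced and consistent BECAUSE the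
  difference is additive; `ε = κ·(least margin)`, then the least room over the finitely many pairs).
* Registered form `triangle_planeLocal_add`: `(∃ ε > 0, DictSolvesL ε H) ↔ AddSolves H` for non-negative `H`.
So: plane-local factorisations of the shifted triangle matrix with `o(t³)` atoms exist for some `ε = ε(t) > 0` iff
dictionaries of `o(t²)` non-negative `t × t` matrices satisfy `AddSolves` — one ε-free statement per `t` (memo
`PLANELOCAL-seat3.md`).  The "coupled hooks" of `…TrianglePlaneLocal` are `AddSolves` with additivity relaxed to
inequalities and are NOT sufficient.  Nothing here is cited; everything is elementary.
-/

set_option linter.dupNamespace false -- `Summit.PneNP.PneNP.…`: summit = sub-problem (D-0017)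

namespace Summit.PneNP.PneNP.Theorems.XorDoor.TriLine

open Finset

noncomputable section

variable {t : ℕ}

/-- One pair `(P,S)` of the dictionary problem with free lines at room `ε` (the inner statement of `DictSolvesL`). -/
def PairSolvesL (ε : ℝ) {ι : Type} [Fintype ι] (H : ι → Fin t → Fin t → ℝ) (P S : Fin t → Bool) : Prop :=
  ∃ (E : Fin t → Fin t → ℝ) (c₀ c₁ : ι → ℝ) (f₀ g₀ f₁ g₁ : Fin t → ℝ),
    (∀ a d, 0 ≤ E a d) ∧ (∀ a d, E a d ≤ 1 - ε) ∧ (∀ i, 0 ≤ c₀ i) ∧ (∀ i, 0 ≤ c₁ i) ∧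
    (∀ a, 0 ≤ f₀ a) ∧ (∀ d, 0 ≤ g₀ d) ∧ (∀ a, 0 ≤ f₁ a) ∧ (∀ d, 0 ≤ g₁ d) ∧
    (∀ a d, ∑ i, c₀ i * H i a d + f₀ a + g₀ d = box P S true a d + E a d) ∧
    (∀ a d, ∑ i, c₁ i * H i a d + f₁ a + g₁ d = box P S false a d + E a d)

/-- `DictSolvesL` is the pairwise statement at every pair -/
lemma dictSolvesL_iff_pairSolvesL {ε : ℝ} {ι : Type} [Fintype ι] (H : ι → Fin t → Fin t → ℝ) :
    DictSolvesL ε H ↔ ∀ P S, PairSolvesL ε H P S := Iff.rfl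

/-- shrinking the room `ε` only relaxes the problem -/
lemma pairSolvesL_mono {ε ε' : ℝ} {ι : Type} [Fintype ι] {H : ι → Fin t → Fin t → ℝ} {P S : Fin t → Bool}
    (h : PairSolvesL ε H P S) (hε : ε' ≤ ε) : PairSolvesL ε' H P S := by
  obtain ⟨E, c₀, c₁, f₀, g₀, f₁, g₁, hE0, hE1, rest⟩ := h
  exact ⟨E, c₀, c₁, f₀, g₀, f₁, g₁, hE0, fun a d => (hE1 a d).trans (by linarith), rest⟩

/-- A pair with an empty class is solved by the lines alone (background `0`), at every room `ε ≤ 1`. -/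
lemma pairSolvesL_degenerate {ε : ℝ} (hε : ε ≤ 1) {ι : Type} [Fintype ι] (H : ι → Fin t → Fin t → ℝ)
    {P S : Fin t → Bool}
    (hdeg : (∀ a, P a = true) ∨ (∀ a, P a = false) ∨ (∀ d, S d = true) ∨ (∀ d, S d = false)) :
    PairSolvesL ε H P S := by
  rcases hdeg with hP | hP | hS | hS
  · -- all rows in `P`: box true = columns of `S`, box false = ∅
    refine ⟨fun _ _ => 0, fun _ => 0, fun _ => 0, fun _ => 0, fun d => if S d = true then 2 else 0,
      fun _ => 0, fun _ => 0, fun _ _ => le_rfl, fun _ _ => by linarith, fun _ => le_rfl, fun _ => le_rfl,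
      fun _ => le_rfl, fun d => by dsimp only; split_ifs <;> norm_num, fun _ => le_rfl, fun _ => le_rfl, ?_, ?_⟩
    · intro a d; simp only [zero_mul, Finset.sum_const_zero, zero_add, add_zero]; unfold box
      cases hSd : S d <;> simp [hP a]
    · intro a d; simp only [zero_mul, Finset.sum_const_zero, add_zero]; unfold box
      simp [hP a]
  · -- no row in `P`: box true = ∅, box false = columns of `Sᶜ`
    refine ⟨fun _ _ => 0, fun _ => 0, fun _ => 0, fun _ => 0, fun _ => 0, fun _ => 0,
      fun d => if S d = false then 2 else 0, fun _ _ => le_rfl, fun _ _ => by linarith, fun _ => le_rfl,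
      fun _ => le_rfl, fun _ => le_rfl, fun _ => le_rfl, fun _ => le_rfl,
      fun d => by dsimp only; split_ifs <;> norm_num, ?_, ?_⟩
    · intro a d; simp only [zero_mul, Finset.sum_const_zero, add_zero]; unfold box
      simp [hP a]
    · intro a d; simp only [zero_mul, Finset.sum_const_zero, zero_add, add_zero]; unfold box
      cases hSd : S d <;> simp [hP a]
  · -- all columns in `S`: box true = rows of `P`, box false = ∅
    refine ⟨fun _ _ => 0, fun _ => 0, fun _ => 0, fun a => if P a = true then 2 else 0, fun _ => 0,
      fun _ => 0, fun _ => 0, fun _ _ => le_rfl, fun _ _ => by linarith, fun _ => le_rfl, fun _ => le_rfl,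
      fun a => by dsimp only; split_ifs <;> norm_num, fun _ => le_rfl, fun _ => le_rfl, fun _ => le_rfl, ?_, ?_⟩
    · intro a d; simp only [zero_mul, Finset.sum_const_zero, zero_add, add_zero]; unfold box
      cases hPa : P a <;> simp [hS d]
    · intro a d; simp only [zero_mul, Finset.sum_const_zero, add_zero]; unfold box
      simp [hS d]
  · -- no column in `S`: box true = ∅, box false = rows of `Pᶜ`
    refine ⟨fun _ _ => 0, fun _ => 0, fun _ => 0, fun _ => 0, fun _ => 0,
      fun a => if P a = false then 2 else 0, fun _ => 0, fun _ _ => le_rfl, fun _ _ => by linarith,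
      fun _ => le_rfl, fun _ => le_rfl, fun _ => le_rfl, fun _ => le_rfl,
      fun a => by dsimp only; split_ifs <;> norm_num, fun _ => le_rfl, ?_, ?_⟩
    · intro a d; simp only [zero_mul, Finset.sum_const_zero, add_zero]; unfold box
      simp [hS d]
    · intro a d; simp only [zero_mul, Finset.sum_const_zero, zero_add, add_zero]; unfold box
      cases hPa : P a <;> simp [hS d]

/-! ## The additive coupling condition -/

/-- **The additive coupling condition** (the exact scale-free limit of `(D_ε)` as `ε → 0⁺`): at every pair `(P,S)`
with all four classes non-empty there are two non-negative combinations `X₀ = ∑ c₀ᵢ Hᵢ`, `X₁ = ∑ c₁ᵢ Hᵢ` whose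
difference is ADDITIVE with the block sign pattern, and with `X₀` below the row constant on `P × Sᶜ` and below the
column constant on `Pᶜ × S`. -/
def AddSolves {ι : Type} [Fintype ι] (H : ι → Fin t → Fin t → ℝ) : Prop :=
  ∀ P S : Fin t → Bool, (∃ a, P a = true) → (∃ a, P a = false) → (∃ d, S d = true) → (∃ d, S d = false) →
    ∃ (c₀ c₁ : ι → ℝ) (α β : Fin t → ℝ), (∀ i, 0 ≤ c₀ i) ∧ (∀ i, 0 ≤ c₁ i) ∧
      (∀ a d, ∑ i, c₀ i * H i a d - ∑ i, c₁ i * H i a d = α a + β d) ∧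
      (∀ a, P a = true → 0 < α a) ∧ (∀ a, P a = false → α a < 0) ∧
      (∀ d, S d = true → 0 < β d) ∧ (∀ d, S d = false → β d < 0) ∧
      (∀ a d, P a = true → S d = false → ∑ i, c₀ i * H i a d < α a) ∧
      (∀ a d, P a = false → S d = true → ∑ i, c₀ i * H i a d < β d)

/-- **Necessity.**  A non-negative dictionary solving `(D_ε)` with free lines at some room `ε > 0` satisfies the
additive coupling condition: `α a = 2[a ∈ P] − 1 − f₀ a + f₁ a`, `β d = 2[d ∈ S] − 1 − g₀ d + g₁ d`. -/
theorem addSolves_of_dictSolvesL {ε : ℝ} (hε : 0 < ε) {ι : Type} [Fintype ι] {H : ι → Fin t → Fin t → ℝ}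
    (hH : ∀ i a d, 0 ≤ H i a d) (h : DictSolvesL ε H) : AddSolves H := by
  intro P S hP1 hP0 hS1 hS0
  obtain ⟨E, c₀, c₁, f₀, g₀, f₁, g₁, _, hE1, hc₀, hc₁, hf₀, hg₀, hf₁, hg₁, h₀, h₁⟩ := h P S
  obtain ⟨d₀, hd₀⟩ := hS0
  obtain ⟨d₁, hd₁⟩ := hS1
  obtain ⟨a₀, ha₀⟩ := hP0
  obtain ⟨a₁, ha₁⟩ := hP1
  have hX0 : ∀ a d, 0 ≤ ∑ i, c₀ i * H i a d := fun a d =>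
    Finset.sum_nonneg fun i _ => mul_nonneg (hc₀ i) (hH i a d)
  have hX1 : ∀ a d, 0 ≤ ∑ i, c₁ i * H i a d := fun a d =>
    Finset.sum_nonneg fun i _ => mul_nonneg (hc₁ i) (hH i a d)
  refine ⟨c₀, c₁, fun a => (if P a = true then 2 else 0) - 1 - f₀ a + f₁ a,
    fun d => (if S d = true then 2 else 0) - 1 - g₀ d + g₁ d, hc₀, hc₁, ?_, ?_, ?_, ?_, ?_, ?_, ?_⟩
  · -- the difference is additive: box true − box false = (2[P]−1) ⊕ (2[S]−1)
    intro a d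
    have e₀ := h₀ a d
    have e₁ := h₁ a d
    unfold box at e₀ e₁
    rcases Bool.eq_false_or_eq_true (P a) with hPa | hPa <;>
      rcases Bool.eq_false_or_eq_true (S d) with hSd | hSd <;>
      simp only [hPa, hSd, Bool.true_eq_false, Bool.false_eq_true, and_self, and_true, and_false,
        ↓reduceIte] at e₀ e₁ ⊢ <;> linarith
  · -- `α > 0` on `P`: read `f₀ a ≤ 1 − ε` in the column `d₀ ∉ S`
    intro a hPa
    have e := h₀ a d₀
    have hb : box P S true a d₀ = 0 := by
      unfold box; rw [if_neg]; rintro ⟨_, h⟩; rw [hd₀] at h; exact Bool.noConfusion h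
    rw [hb] at e
    have := hE1 a d₀; have := hX0 a d₀; have := hg₀ d₀; have := hf₁ a
    simp only [hPa, ↓reduceIte]; linarith
  · -- `α < 0` off `P`: read `f₁ a ≤ 1 − ε` in the column `d₁ ∈ S`
    intro a hPa
    have e := h₁ a d₁
    have hb : box P S false a d₁ = 0 := by
      unfold box; rw [if_neg]; rintro ⟨_, h⟩; rw [hd₁] at h; exact Bool.noConfusion h
    rw [hb] at e
    have := hE1 a d₁; have := hX1 a d₁; have := hg₁ d₁; have := hf₀ a
    simp only [hPa, Bool.false_eq_true, ↓reduceIte]; linarith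
  · intro d hSd
    have e := h₀ a₀ d
    have hb : box P S true a₀ d = 0 := by
      unfold box; rw [if_neg]; rintro ⟨h, _⟩; rw [ha₀] at h; exact Bool.noConfusion h
    rw [hb] at e
    have := hE1 a₀ d; have := hX0 a₀ d; have := hf₀ a₀; have := hg₁ d
    simp only [hSd, ↓reduceIte]; linarith
  · intro d hSd
    have e := h₁ a₁ d
    have hb : box P S false a₁ d = 0 := by
      unfold box; rw [if_neg]; rintro ⟨h, _⟩; rw [ha₁] at h; exact Bool.noConfusion h
    rw [hb] at e
    have := hE1 a₁ d; have := hX1 a₁ d; have := hf₁ a₁; have := hg₀ d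
    simp only [hSd, Bool.false_eq_true, ↓reduceIte]; linarith
  · -- `X₀(a,d) < α a` on `P × Sᶜ`
    intro a d hPa hSd
    have e := h₀ a d
    have hb : box P S true a d = 0 := by
      unfold box; rw [if_neg]; rintro ⟨_, h⟩; rw [hSd] at h; exact Bool.noConfusion h
    rw [hb] at e
    have := hE1 a d; have := hg₀ d; have := hf₁ a
    simp only [hPa, ↓reduceIte]; linarith
  · -- `X₀(a,d) < β d` on `Pᶜ × S`
    intro a d hPa hSd
    have e := h₀ a d
    have hb : box P S true a d = 0 := by
      unfold box; rw [if_neg]; rintro ⟨h, _⟩; rw [hPa] at h; exact Bool.noConfusion h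
    rw [hb] at e
    have := hE1 a d; have := hf₀ a; have := hg₁ d
    simp only [hSd, ↓reduceIte]; linarith

/-- **Sufficiency, one pair.**  From additive-coupling data at a non-degenerate pair, a solution of that pair of
`(D_ε)` with free lines at some room `ε > 0`: scale by a small `κ`, put the lines `1 − κα` on the rows of `P` (for
`X₀`), `1 + κα` on the rows off `P` (for `X₁`), the columns likewise; the background is forced, and consistent
because the difference is additive. -/
theorem pairSolvesL_of_add {ι : Type} [Fintype ι] {H : ι → Fin t → Fin t → ℝ} (hH : ∀ i a d, 0 ≤ H i a d)
    {P S : Fin t → Bool} (hP1 : ∃ a, P a = true) (hS0 : ∃ d, S d = false)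
    {c₀ c₁ : ι → ℝ} {α β : Fin t → ℝ} (hc₀ : ∀ i, 0 ≤ c₀ i) (hc₁ : ∀ i, 0 ≤ c₁ i)
    (hadd : ∀ a d, ∑ i, c₀ i * H i a d - ∑ i, c₁ i * H i a d = α a + β d)
    (hB : ∀ a d, P a = true → S d = false → ∑ i, c₀ i * H i a d < α a)
    (hC : ∀ a d, P a = false → S d = true → ∑ i, c₀ i * H i a d < β d) :
    ∃ ε, 0 < ε ∧ PairSolvesL ε H P S := by
  classical
  -- shorthand for the two combinations
  set X₀ : Fin t → Fin t → ℝ := fun a d => ∑ i, c₀ i * H i a d with hX₀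
  set X₁ : Fin t → Fin t → ℝ := fun a d => ∑ i, c₁ i * H i a d with hX₁
  have hX0 : ∀ a d, 0 ≤ X₀ a d := fun a d => Finset.sum_nonneg fun i _ => mul_nonneg (hc₀ i) (hH i a d)
  have hX1 : ∀ a d, 0 ≤ X₁ a d := fun a d => Finset.sum_nonneg fun i _ => mul_nonneg (hc₁ i) (hH i a d)
  have hadd' : ∀ a d, X₀ a d - X₁ a d = α a + β d := hadd
  have hB' : ∀ a d, P a = true → S d = false → X₀ a d < α a := hB
  have hC' : ∀ a d, P a = false → S d = true → X₀ a d < β d := hC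
  -- a common bound `M ≥ 1` on every quantity that must stay `≤ 1/2` after scaling
  set M : ℝ := 1 + ∑ a, |α a| + ∑ d, |β d| + ∑ a, ∑ d, (X₀ a d + X₁ a d) with hM
  have hsumX : 0 ≤ ∑ a, ∑ d, (X₀ a d + X₁ a d) :=
    Finset.sum_nonneg fun a _ => Finset.sum_nonneg fun d _ => add_nonneg (hX0 a d) (hX1 a d)
  have hsumα : 0 ≤ ∑ a, |α a| := Finset.sum_nonneg fun a _ => abs_nonneg _
  have hsumβ : 0 ≤ ∑ d, |β d| := Finset.sum_nonneg fun d _ => abs_nonneg _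
  have hMpos : 0 < M := by rw [hM]; linarith
  have hαM : ∀ a, |α a| ≤ M := by
    intro a
    have : |α a| ≤ ∑ a, |α a| := Finset.single_le_sum (fun a _ => abs_nonneg (α a)) (Finset.mem_univ a)
    rw [hM]; linarith
  have hβM : ∀ d, |β d| ≤ M := by
    intro d
    have : |β d| ≤ ∑ d, |β d| := Finset.single_le_sum (fun d _ => abs_nonneg (β d)) (Finset.mem_univ d)
    rw [hM]; linarith
  have hXM : ∀ a d, X₀ a d + X₁ a d ≤ M := by
    intro a d
    have h1 : X₀ a d + X₁ a d ≤ ∑ d, (X₀ a d + X₁ a d) :=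
      Finset.single_le_sum (fun d _ => add_nonneg (hX0 a d) (hX1 a d)) (Finset.mem_univ d)
    have h2 : ∑ d, (X₀ a d + X₁ a d) ≤ ∑ a, ∑ d, (X₀ a d + X₁ a d) :=
      Finset.single_le_sum (fun a _ => Finset.sum_nonneg fun d _ => add_nonneg (hX0 a d) (hX1 a d))
        (Finset.mem_univ a)
    rw [hM]; linarith
  -- the scale `κ = 1/(2M)`: every scaled quantity is at most `1/2`
  set κ : ℝ := 1 / (2 * M) with hκ
  have hκpos : 0 < κ := by rw [hκ]; positivity
  have hκM : κ * M = 1 / 2 := by rw [hκ]; field_simp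
  have hhalf : ∀ x : ℝ, x ≤ M → κ * x ≤ 1 / 2 := fun x hx => by
    calc κ * x ≤ κ * M := mul_le_mul_of_nonneg_left hx hκpos.le
      _ = 1 / 2 := hκM
  -- the least margin `μ > 0` over the two off-diagonal classes
  set T : Finset ℝ :=
    ((Finset.univ.filter fun ad : Fin t × Fin t => P ad.1 = true ∧ S ad.2 = false).image
        fun ad => α ad.1 - X₀ ad.1 ad.2) ∪
      ((Finset.univ.filter fun ad : Fin t × Fin t => P ad.1 = false ∧ S ad.2 = true).image
        fun ad => β ad.2 - X₀ ad.1 ad.2) with hT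
  obtain ⟨a₁, ha₁⟩ := hP1
  obtain ⟨d₀, hd₀⟩ := hS0
  have memB : ∀ a d, P a = true → S d = false → α a - X₀ a d ∈ T := by
    intro a d ha hd
    rw [hT, Finset.mem_union]; left
    rw [Finset.mem_image]
    exact ⟨(a, d), by rw [Finset.mem_filter]; exact ⟨Finset.mem_univ _, ha, hd⟩, rfl⟩
  have memC : ∀ a d, P a = false → S d = true → β d - X₀ a d ∈ T := by
    intro a d ha hd
    rw [hT, Finset.mem_union]; right
    rw [Finset.mem_image]
    exact ⟨(a, d), by rw [Finset.mem_filter]; exact ⟨Finset.mem_univ _, ha, hd⟩, rfl⟩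
  have hTne : T.Nonempty := ⟨_, memB a₁ d₀ ha₁ hd₀⟩
  have hTpos : ∀ x ∈ T, 0 < x := by
    intro x hx
    rw [hT, Finset.mem_union, Finset.mem_image, Finset.mem_image] at hx
    rcases hx with ⟨ad, had, rfl⟩ | ⟨ad, had, rfl⟩
    · rw [Finset.mem_filter] at had
      have := hB' ad.1 ad.2 had.2.1 had.2.2
      linarith
    · rw [Finset.mem_filter] at had
      have := hC' ad.1 ad.2 had.2.1 had.2.2
      linarith
  set μ : ℝ := T.min' hTne with hμ
  have hμpos : 0 < μ := by rw [hμ]; exact hTpos _ (Finset.min'_mem T hTne)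
  have hμB : ∀ a d, P a = true → S d = false → μ ≤ α a - X₀ a d :=
    fun a d ha hd => Finset.min'_le T _ (memB a d ha hd)
  have hμC : ∀ a d, P a = false → S d = true → μ ≤ β d - X₀ a d :=
    fun a d ha hd => Finset.min'_le T _ (memC a d ha hd)
  have hμM : μ ≤ M := by
    have h1 := hμB a₁ d₀ ha₁ hd₀
    have h2 := hαM a₁
    have h3 := le_abs_self (α a₁)
    have h4 := hX0 a₁ d₀
    linarith
  have hκμ : κ * μ ≤ 1 / 2 := hhalf μ hμM
  -- the room `ε = κμ`
  refine ⟨κ * μ, mul_pos hκpos hμpos, ?_⟩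
  refine ⟨fun a d => κ * X₀ a d + (if P a = true then 1 - κ * α a else 0) +
      (if S d = true then 1 - κ * β d else 0) - box P S true a d,
    fun i => κ * c₀ i, fun i => κ * c₁ i,
    fun a => if P a = true then 1 - κ * α a else 0, fun d => if S d = true then 1 - κ * β d else 0,
    fun a => if P a = false then 1 + κ * α a else 0, fun d => if S d = false then 1 + κ * β d else 0,
    ?_, ?_, ?_, ?_, ?_, ?_, ?_, ?_, ?_, ?_⟩
  · -- `E ≥ 0`
    intro a d
    unfold box
    rcases Bool.eq_false_or_eq_true (P a) with hPa | hPa <;>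
      rcases Bool.eq_false_or_eq_true (S d) with hSd | hSd <;>
      simp only [hPa, hSd, Bool.false_eq_true, and_self, and_true, and_false, ↓reduceIte]
    · -- class A: `E = κ X₁`
      have e := hadd' a d
      have h1 : 0 ≤ κ * X₁ a d := mul_nonneg hκpos.le (hX1 a d)
      have : κ * X₀ a d + (1 - κ * α a) + (1 - κ * β d) - 2 = κ * X₁ a d := by
        have : X₁ a d = X₀ a d - α a - β d := by linarith
        rw [this]; ring
      linarith
    · -- class B: `E = 1 − κ(α − X₀) ≥ 1/2`
      have h1 : κ * (α a - X₀ a d) ≤ 1 / 2 := by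
        apply hhalf
        have := hαM a; have := le_abs_self (α a); have := hX0 a d; linarith
      nlinarith
    · -- class C
      have h1 : κ * (β d - X₀ a d) ≤ 1 / 2 := by
        apply hhalf
        have := hβM d; have := le_abs_self (β d); have := hX0 a d; linarith
      nlinarith
    · -- class D: `E = κ X₀`
      nlinarith [mul_nonneg hκpos.le (hX0 a d)]
  · -- `E ≤ 1 − κμ`
    intro a d
    unfold box
    rcases Bool.eq_false_or_eq_true (P a) with hPa | hPa <;>
      rcases Bool.eq_false_or_eq_true (S d) with hSd | hSd <;>
      simp only [hPa, hSd, Bool.false_eq_true, and_self, and_true, and_false, ↓reduceIte]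
    · -- class A: `κ X₁ ≤ 1/2 ≤ 1 − κμ`
      have e := hadd' a d
      have h1 : κ * X₁ a d ≤ 1 / 2 := hhalf _ (by have := hXM a d; have := hX0 a d; linarith)
      have : κ * X₀ a d + (1 - κ * α a) + (1 - κ * β d) - 2 = κ * X₁ a d := by
        have : X₁ a d = X₀ a d - α a - β d := by linarith
        rw [this]; ring
      linarith
    · -- class B: `1 − κ(α − X₀) ≤ 1 − κμ`
      have h1 := mul_le_mul_of_nonneg_left (hμB a d hPa hSd) hκpos.le
      nlinarith
    · have h1 := mul_le_mul_of_nonneg_left (hμC a d hPa hSd) hκpos.le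
      nlinarith
    · have h1 : κ * X₀ a d ≤ 1 / 2 := hhalf _ (by have := hXM a d; have := hX1 a d; linarith)
      nlinarith
  · intro i; exact mul_nonneg hκpos.le (hc₀ i)
  · intro i; exact mul_nonneg hκpos.le (hc₁ i)
  · intro a; dsimp only; split_ifs with hPa
    · have h1 : κ * α a ≤ 1 / 2 := hhalf _ ((le_abs_self _).trans (hαM a))
      linarith
    · exact le_rfl
  · intro d; dsimp only; split_ifs with hSd
    · have h1 : κ * β d ≤ 1 / 2 := hhalf _ ((le_abs_self _).trans (hβM d))
      linarith
    · exact le_rfl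
  · intro a; dsimp only; split_ifs with hPa
    · have h1 : κ * (-α a) ≤ 1 / 2 := hhalf _ ((neg_le_abs _).trans (hαM a))
      linarith
    · exact le_rfl
  · intro d; dsimp only; split_ifs with hSd
    · have h1 : κ * (-β d) ≤ 1 / 2 := hhalf _ ((neg_le_abs _).trans (hβM d))
      linarith
    · exact le_rfl
  · -- the `X₀` representation: true by the definition of `E`
    intro a d
    have : ∑ i, κ * c₀ i * H i a d = κ * X₀ a d := by
      simp only [hX₀, Finset.mul_sum, mul_assoc]
    rw [this]; ring
  · -- the `X₁` representation: consistent because `X₀ − X₁ = α ⊕ β`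
    intro a d
    have : ∑ i, κ * c₁ i * H i a d = κ * X₁ a d := by
      simp only [hX₁, Finset.mul_sum, mul_assoc]
    rw [this]
    have e := hadd' a d
    have eX1 : κ * X₁ a d = κ * X₀ a d - κ * α a - κ * β d := by
      have : X₁ a d = X₀ a d - α a - β d := by linarith
      rw [this]; ring
    unfold box
    rcases Bool.eq_false_or_eq_true (P a) with hPa | hPa <;>
      rcases Bool.eq_false_or_eq_true (S d) with hSd | hSd <;>
      simp only [hPa, hSd, Bool.true_eq_false, Bool.false_eq_true, and_self, and_true, and_false, ↓reduceIte] <;>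
      linarith

/-- **Sufficiency.**  A non-negative dictionary satisfying the additive coupling condition solves `(D_ε)` with free
lines at some room `ε > 0` (the least of the finitely many pairwise rooms; degenerate pairs are solved by lines). -/
theorem dictSolvesL_of_addSolves {ι : Type} [Fintype ι] {H : ι → Fin t → Fin t → ℝ}
    (hH : ∀ i a d, 0 ≤ H i a d) (h : AddSolves H) : ∃ ε, 0 < ε ∧ DictSolvesL ε H := by
  classical
  -- a positive room for every pair
  have hpair : ∀ PS : (Fin t → Bool) × (Fin t → Bool), ∃ ε, 0 < ε ∧ PairSolvesL ε H PS.1 PS.2 := by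
    rintro ⟨P, S⟩
    by_cases hdeg : (∀ a, P a = true) ∨ (∀ a, P a = false) ∨ (∀ d, S d = true) ∨ (∀ d, S d = false)
    · exact ⟨1, one_pos, pairSolvesL_degenerate le_rfl H hdeg⟩
    · simp only [not_or, not_forall] at hdeg
      obtain ⟨⟨a₀, ha₀⟩, ⟨a₁, ha₁⟩, ⟨d₀, hd₀⟩, ⟨d₁, hd₁⟩⟩ := hdeg
      have hP1 : ∃ a, P a = true := ⟨a₁, by simpa using ha₁⟩
      have hP0 : ∃ a, P a = false := ⟨a₀, by simpa using ha₀⟩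
      have hS1 : ∃ d, S d = true := ⟨d₁, by simpa using hd₁⟩
      have hS0 : ∃ d, S d = false := ⟨d₀, by simpa using hd₀⟩
      obtain ⟨c₀, c₁, α, β, hc₀, hc₁, hadd, _, _, _, _, hB, hC⟩ := h P S hP1 hP0 hS1 hS0
      exact pairSolvesL_of_add hH hP1 hS0 hc₀ hc₁ hadd hB hC
  choose εf hεpos hεsol using hpair
  -- the least room over the finitely many pairs
  have hne : (Finset.univ : Finset ((Fin t → Bool) × (Fin t → Bool))).Nonempty :=
    ⟨(fun _ => true, fun _ => true), Finset.mem_univ _⟩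
  refine ⟨Finset.univ.inf' hne εf, ?_, ?_⟩
  · rw [Finset.lt_inf'_iff]; intro PS _; exact hεpos PS
  · intro P S
    exact pairSolvesL_mono (hεsol (P, S)) (Finset.inf'_le εf (Finset.mem_univ (P, S)))

/-- Registered form (crux stmt-PneNP-10680, sub-goal `triangle_planeLocal_add`): for a non-negative dictionary,
solving the per-plane dictionary problem with free lines at SOME room `ε > 0` is equivalent to the ε-free additive
coupling condition. -/
theorem triangle_planeLocal_add : ∀ {t : ℕ} {ι : Type} [Fintype ι] {H : ι → Fin t → Fin t → ℝ}, (∀ i a d, 0 ≤ H i a d) → ((∃ ε : ℝ, 0 < ε ∧ DictSolvesL ε H) ↔ AddSolves H) :=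
  fun hH => ⟨fun ⟨_, hε, h⟩ => addSolves_of_dictSolvesL hε hH h, fun h => dictSolvesL_of_addSolves hH h⟩

end

end Summit.PneNP.PneNP.Theorems.XorDoor.TriLine
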